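import Summits.BirchSwinnertonDyer.BirchSwinnertonDyer.Theorems.AdditiveBranchIMCTwistRootNumberTwistedClassArith
import Summits.BirchSwinnertonDyer.BirchSwinnertonDyer.Theorems.AdditiveBranchIMCTwistAtTwoLocalRootNumber
import Summits.BirchSwinnertonDyer.BirchSwinnertonDyer.Theorems.AdditiveBranchIMCTwistAtTwoAtkinLehnerInvariance
import HarnessLib

/-!
# The E3′ root-number engine — KRONECKER form, ANY TWIST-TYPE REDUCTION AT `2` (LEAD g18; door A2 «additive `2` on E3′ rows» of 19357 `three_field_road`)
Theorems only. The Kronecker engine `rootNumber_quadraticTwist_eq_of_potMult_kronecker` (p812792, LEAD g17) VERBATIM with its binder «`E` not additive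
at `2`» REPLACED by the sub-row's dyadic twist-type clause («if `E` is additive at `2` then `E^{(t)}` is not, for some `t ∈ {−1, 2, −2}`»): at such a
`2` the level keeps `2` to an exponent `≥ 2`, so the engine's factor at `2` is `1`, and `λ₂(f_{E^{(D)}}) = λ₂(f_E) = χ_t(−1)`
(`atkinLehnerEigenvalueAt_two_quadraticTwist_eq_of_twistType_two`, p-next of LEAD g18; Atkin–Li 1978 §3 via p814752). Reduction types at `2` along the
twist `D ≡ 1 (mod 4)` are compared through `f₂` (`hasReductionAt_two_quadraticTwist_iff_of_emod_four_eq_one`), uniformly in the type.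
`w(E^{(D)}) = χ₄(|D|)·(∏_{r ∥ N_E, r ≠ ℓ₀} k_r(D))·w(E)`, `k_2 = χ₈`, `k_r = (D/r)` (odd `r`). BSD is proved for no curve. [AtkinLi1978] §3; [Rohrlich1993Compositio] Prop. 2–3.
-/

set_option linter.dupNamespace false
set_option autoImplicit false

noncomputable section

open scoped MatrixGroups Classical

open CongruenceSubgroup Literature.NumberTheory.EllipticCurves Literature.NumberTheory.EllipticCurves.ModularForms
  IsDedekindDomain IsDedekindDomain.HeightOneSpectrum NumberField Rat.HeightOneSpectrum WeierstrassCurve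
  Summit.BirchSwinnertonDyer.Rank1Residual Summit.BirchSwinnertonDyer.BirchSwinnertonDyer.Theorems NumberTheorySymbols

namespace Summit.BirchSwinnertonDyer.BirchSwinnertonDyer.Theorems.TwistRootNumberTwisted

variable (W : WeierstrassCurve ℚ) [W.IsElliptic] [W.IsGloballyMinimal]

/-- **The E3′ root-number engine, Kronecker form, any twist-type reduction at `2`** (see the module docstring): `w(E^{(D)}) = χ₄(|D|)·(∏_{r ∥ N_E, r ≠ ℓ₀} k_r(D))·w(E)`,
`k_2 = χ₈`, `k_r = (D/r)` for odd `r`; NO condition on `D` modulo `8`; `E` additive at `2` allowed when of quadratic-twist type.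
[cite: AtkinLi1978, §1 and §3] [cite: Rohrlich1993Compositio, Prop. 2 (ii)–(iii) and Prop. 3] [cite: SilvermanAEC2009, Ex. 10.16, App. A Prop. A.1.1 and X.5 Cor. 5.4] -/
theorem rootNumber_quadraticTwist_eq_of_potMult_kronecker_anyTwo (hmod : exists_isNewformOf)
    (htt : ∀ p : Nat.Primes, (p : ℕ) ≠ 2 → W.HasAdditiveReductionAt ((primesEquiv (R := ℤ)).symm p) →
      ¬ (W.quadraticTwist (((-1 : ℤ) ^ ((p : ℕ) / 2) * p : ℤ) : ℚ)).HasAdditiveReductionAt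
        ((primesEquiv (R := ℤ)).symm p))
    (h2tt : ∀ r : Nat.Primes, (r : ℕ) = 2 → W.HasAdditiveReductionAt ((primesEquiv (R := ℤ)).symm r) →
      ∃ t : ℤ, (t = -1 ∨ t = 2 ∨ t = -2) ∧ ¬ (W.quadraticTwist (t : ℚ)).HasAdditiveReductionAt ((primesEquiv (R := ℤ)).symm r))
    {ℓ₀ : ℕ} [hℓ₀ : Fact ℓ₀.Prime] (hℓ₀2 : ℓ₀ ≠ 2)
    (hadd₀ : W.HasAdditiveReductionAt ((primesEquiv (R := ℤ)).symm ⟨ℓ₀, hℓ₀.out⟩))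
    (hmult₀ : (W.quadraticTwist (((-1 : ℤ) ^ (ℓ₀ / 2) * ℓ₀ : ℤ) : ℚ)).HasMultiplicativeReductionAtPrime ℓ₀)
    {D m : ℤ} (hDm : D = (-1 : ℤ) ^ (ℓ₀ / 2) * ℓ₀ * m) (hD4 : D % 4 = 1) (hmsq : Squarefree m)
    (hℓ₀m : ¬ (ℓ₀ : ℤ) ∣ m) (hgood : ∀ r : Nat.Primes, ((r : ℕ) : ℤ) ∣ m → W.HasGoodReductionAt ((primesEquiv (R := ℤ)).symm r))
    (hnsD : ¬ (W.quadraticTwist (D : ℚ)).HasSplitMultiplicativeReductionAtPrime ℓ₀) :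
    (W.quadraticTwist (D : ℚ)).rootNumber =
      ZMod.χ₄ (D.natAbs : ZMod 4) *
        (∏ r ∈ (W.conductorNorm ℤ).primeFactors.erase ℓ₀,
          (if (W.conductorNorm ℤ).factorization r = 1 then (if r = 2 then ZMod.χ₈ (D : ZMod 8) else jacobiSym D r) else 1)) *
        W.rootNumber := by
  set s : ℤ := (-1 : ℤ) ^ (ℓ₀ / 2) * ℓ₀ with hs
  have hs0 : s ≠ 0 := mul_ne_zero (pow_ne_zero _ (by norm_num)) (by exact_mod_cast hℓ₀.out.ne_zero)
  have hm0 : m ≠ 0 := by rintro rfl; exact hℓ₀m (dvd_zero _)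
  have hD0 : D ≠ 0 := by rw [hDm]; exact mul_ne_zero hs0 hm0
  have hDQ : (D : ℚ) ≠ 0 := by exact_mod_cast hD0
  set W' := W.quadraticTwist (D : ℚ) with hW'
  haveI : W'.IsElliptic := W.isElliptic_quadraticTwist hDQ
  set W₁ := W.quadraticTwist ((s : ℤ) : ℚ) with hW₁
  haveI : W₁.IsElliptic := W.isElliptic_quadraticTwist (show ((s : ℤ) : ℚ) ≠ 0 by exact_mod_cast hs0)
  set Pℓ : Nat.Primes := ⟨ℓ₀, hℓ₀.out⟩ with hPℓ
  set P2 : Nat.Primes := ⟨2, Nat.prime_two⟩ with hP2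
  set vℓ : HeightOneSpectrum ℤ := (primesEquiv (R := ℤ)).symm Pℓ with hvℓ
  set N := W.conductorNorm ℤ with hN
  set N' := W'.conductorNorm ℤ with hN'
  have hN0 : N ≠ 0 := (W.conductorNorm_pos_holds).ne'
  have hN'0 : N' ≠ 0 := (W'.conductorNorm_pos_holds).ne'
  have hM0 : m.natAbs ≠ 0 := Int.natAbs_ne_zero.mpr hm0
  haveI : NeZero (W.conductorNorm ℤ) := ⟨hN0⟩
  haveI : NeZero (W'.conductorNorm ℤ) := ⟨hN'0⟩
  have hMsq : Squarefree m.natAbs := Int.squarefree_natAbs.mpr hmsq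
  have hℓ₀s : (ℓ₀ : ℤ) ∣ s := by rw [hs]; exact dvd_mul_left _ _
  have hW'W₁ : W₁.quadraticTwist (m : ℚ) = W' := by
    rw [hW', hW₁, quadraticTwist_quadraticTwist, hDm]; push_cast; ring
  have hDodd : ¬ (2 : ℤ) ∣ D := by omega
  have hmodd : ¬ (2 : ℤ) ∣ m := fun h ↦ hDodd (by rw [hDm]; exact h.mul_left _)
  have hprime_m : ∀ r : Nat.Primes, ((r : ℕ) : ℤ) ∣ m → (r : ℕ) ≠ 2 ∧ (r : ℕ) ≠ ℓ₀ ∧ ¬ (r : ℕ) ∣ N := by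
    intro r hr
    refine ⟨fun h ↦ hmodd (by have h' := hr; rw [h] at h'; exact_mod_cast h'), fun h ↦ hℓ₀m (by rw [← h]; exact hr), fun hrN ↦ ?_⟩
    haveI := Fact.mk r.2
    exact ((W.dvd_conductorNorm_iff_not_hasGoodReductionAtPrime r).mp hrN)
      ((W.hasGoodReductionAtPrime_iff_hasGoodReductionAt_holds r).mpr (hgood r hr))
  have hdvd_D : ∀ r : Nat.Primes, ((r : ℕ) : ℤ) ∣ D → (r : ℕ) = ℓ₀ ∨ ((r : ℕ) : ℤ) ∣ m := by
    intro r hr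
    rw [hDm] at hr
    have hrZ : Prime ((r : ℕ) : ℤ) := Nat.prime_iff_prime_int.mp r.2
    rcases hrZ.dvd_or_dvd hr with h | h
    · left
      have h' : ((r : ℕ) : ℤ) ∣ (ℓ₀ : ℤ) := by
        rw [hs] at h; exact ((isUnit_neg_one (α := ℤ)).pow _).dvd_mul_left.mp h
      exact (Nat.prime_dvd_prime_iff_eq r.2 hℓ₀.out).mp (Int.natCast_dvd_natCast.mp h')
    · exact Or.inr h
  have hℓ₀D : ((ℓ₀ : ℕ) : ℤ) ∣ D := by rw [hDm]; exact hℓ₀s.mul_right _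
  have hbadN_not_dvd_D : ∀ r : Nat.Primes, (r : ℕ) ∣ N → (r : ℕ) ≠ ℓ₀ → ¬ ((r : ℕ) : ℤ) ∣ D := by
    intro r hrN hrℓ hrD
    rcases hdvd_D r hrD with h | h
    · exact hrℓ h
    · exact (hprime_m r h).2.2 hrN
  have hred : ∀ r : Nat.Primes, ¬ ((r : ℕ) : ℤ) ∣ D →
      (W'.HasGoodReductionAt ((primesEquiv (R := ℤ)).symm r) ↔ W.HasGoodReductionAt ((primesEquiv (R := ℤ)).symm r)) ∧
      (W'.HasMultiplicativeReductionAt ((primesEquiv (R := ℤ)).symm r) ↔ W.HasMultiplicativeReductionAt ((primesEquiv (R := ℤ)).symm r)) ∧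
      (W'.HasAdditiveReductionAt ((primesEquiv (R := ℤ)).symm r) ↔ W.HasAdditiveReductionAt ((primesEquiv (R := ℤ)).symm r)) := by
    intro r hrD
    by_cases hr2 : (r : ℕ) = 2
    · -- at `2` (ANY type): `f₂(E^{(D)}) = f₂(E)` for `D ≡ 1 (mod 4)`, and the type is read off `f₂`
      have hr : r = ⟨2, Nat.prime_two⟩ := Subtype.ext hr2
      subst hr
      have h := hasReductionAt_two_quadraticTwist_iff_of_emod_four_eq_one W hD4
      rw [← hW'] at h
      exact h
    · exact W.hasReductionAt_quadraticTwist_iff_of_not_dvd _ (by rw [Rat.natGenerator_primesEquiv_symm]; exact hr2)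
        (by rw [Rat.natGenerator_primesEquiv_symm]; exact hrD)
  have hfac_eq : ∀ r : Nat.Primes, ¬ ((r : ℕ) : ℤ) ∣ D → N'.factorization r = N.factorization r := fun r hrD ↦ by
    simpa only [Rat.natGenerator_primesEquiv_symm] using W.factorization_conductorNorm_quadraticTwist_eq_of_not_dvd hD4
      ((primesEquiv (R := ℤ)).symm r) (by rw [Rat.natGenerator_primesEquiv_symm]; exact hrD)
  have hmultW₁ : W₁.HasMultiplicativeReductionAt vℓ := (W₁.hasMultiplicativeReductionAtPrime_iff_hasMultiplicativeReductionAt_holds Pℓ).mp hmult₀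
  have hmult' : W'.HasMultiplicativeReductionAt vℓ := by
    rw [← hW'W₁]
    exact ((W₁.hasReductionAt_quadraticTwist_iff_of_not_dvd vℓ (by rw [hvℓ, Rat.natGenerator_primesEquiv_symm]; exact hℓ₀2) (d := m)
      (by rw [hvℓ, Rat.natGenerator_primesEquiv_symm]; exact hℓ₀m)).2.1).mpr hmultW₁
  have hmultD : W'.HasMultiplicativeReductionAtPrime ℓ₀ := (W'.hasMultiplicativeReductionAtPrime_iff_hasMultiplicativeReductionAt_holds Pℓ).mpr hmult'
  have hfℓ' : W'.conductorExponent vℓ = 1 := (conductorExponent_eq_one_iff_holds vℓ W').mpr hmult'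
  have hsemi₀ : ¬ W₁.HasAdditiveReductionAt vℓ := hmultW₁.not_hasAdditiveReductionAt
  have hfℓ : W.conductorExponent vℓ = 2 := TwistTypeConductor.conductorExponent_eq_two_of_twistType_odd W Pℓ hℓ₀2 hadd₀ (fun _ ↦ hsemi₀)
  have hlocW' : W'.localRootNumberAt vℓ = 1 := by
    rw [hvℓ, localRootNumberAt_primesEquiv_symm_eq, localRootNumber_of_hasMultiplicativeReduction _ _ hmultD hnsD]
  have hadd_m : ∀ r : Nat.Primes, ((r : ℕ) : ℤ) ∣ m → W'.HasAdditiveReductionAt ((primesEquiv (R := ℤ)).symm r) := by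
    intro r hr
    obtain ⟨hr2, hrℓ, -⟩ := hprime_m r hr
    have h1 : ((r : ℕ) : ℤ) ∣ D := by rw [hDm]; exact hr.mul_left _
    have h2 : ¬ ((r : ℕ) : ℤ) ^ 2 ∣ D := by
      rintro ⟨w, hw⟩
      have hrZ : Prime ((r : ℕ) : ℤ) := Nat.prime_iff_prime_int.mp r.2
      have hr0 : ((r : ℕ) : ℤ) ≠ 0 := by exact_mod_cast r.2.ne_zero
      obtain ⟨u, hu⟩ := hr
      have hsu : s * u = r * w := by
        apply mul_left_cancel₀ hr0
        have : D = (r : ℤ) * (s * u) := by rw [hDm, hu]; ring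
        rw [← this, hw]; ring
      have hrs : ¬ ((r : ℕ) : ℤ) ∣ s := by
        intro h'
        have h'' : ((r : ℕ) : ℤ) ∣ (ℓ₀ : ℤ) := by
          rw [hs] at h'; exact ((isUnit_neg_one (α := ℤ)).pow _).dvd_mul_left.mp h'
        exact hrℓ ((Nat.prime_dvd_prime_iff_eq r.2 hℓ₀.out).mp (Int.natCast_dvd_natCast.mp h''))
      have hru : ((r : ℕ) : ℤ) ∣ u := by
        rcases hrZ.dvd_or_dvd (show ((r : ℕ) : ℤ) ∣ s * u from ⟨w, hsu⟩) with h' | h'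
        · exact absurd h' hrs
        · exact h'
      obtain ⟨t, ht⟩ := hru
      have hr2m : ((r : ℤ) * r) ∣ m := ⟨t, by rw [hu, ht]; ring⟩
      have hunit := hmsq (r : ℤ) hr2m
      rcases Int.isUnit_iff.mp hunit with h1 | h1
      · exact r.2.ne_one (by exact_mod_cast h1)
      · have : (0 : ℤ) ≤ (r : ℕ) := by positivity
        omega
    exact hasAdditiveReductionAt_quadraticTwist_of_good W hD0 r hr2 h1 h2 (hgood r hr)
  have hsemi_m : ∀ r : Nat.Primes, ((r : ℕ) : ℤ) ∣ m →
      ¬ (W'.quadraticTwist (((-1 : ℤ) ^ ((r : ℕ) / 2) * r : ℤ) : ℚ)).HasAdditiveReductionAt ((primesEquiv (R := ℤ)).symm r) := by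
    intro r hr
    obtain ⟨hr2, hrℓ, -⟩ := hprime_m r hr
    obtain ⟨u, hu⟩ := hr
    have hDu : D = r * (s * u) := by rw [hDm, hu]; ring
    have hru : ¬ ((r : ℕ) : ℤ) ∣ s * u := by
      intro h
      have hrZ : Prime ((r : ℕ) : ℤ) := Nat.prime_iff_prime_int.mp r.2
      rcases hrZ.dvd_or_dvd h with h' | h'
      · have h'' : ((r : ℕ) : ℤ) ∣ (ℓ₀ : ℤ) := by
          rw [hs] at h'; exact ((isUnit_neg_one (α := ℤ)).pow _).dvd_mul_left.mp h'
        exact hrℓ ((Nat.prime_dvd_prime_iff_eq r.2 hℓ₀.out).mp (Int.natCast_dvd_natCast.mp h''))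
      · -- `r² ∣ m`
        have hr2m : ((r : ℤ) * r) ∣ m := by rw [hu]; exact mul_dvd_mul_left _ h'
        have hunit := hmsq (r : ℤ) hr2m
        rcases Int.isUnit_iff.mp hunit with h1 | h1
        · exact r.2.ne_one (by exact_mod_cast h1)
        · have : (0 : ℤ) ≤ (r : ℕ) := by positivity
          omega
    exact not_hasAdditiveReductionAt_quadraticTwist_pStar_of_good W r hr2 hDu hru (hgood r ⟨u, hu⟩)
  have hf_m : ∀ r : Nat.Primes, ((r : ℕ) : ℤ) ∣ m → W'.conductorExponent ((primesEquiv (R := ℤ)).symm r) = 2 := fun r hr ↦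
    TwistTypeConductor.conductorExponent_eq_two_of_twistType_odd W' r (hprime_m r hr).1 (hadd_m r hr) (fun _ ↦ hsemi_m r hr)
  have hf_m0 : ∀ r : Nat.Primes, ((r : ℕ) : ℤ) ∣ m → W.conductorExponent ((primesEquiv (R := ℤ)).symm r) = 0 := fun r hr ↦
    (conductorExponent_eq_zero_iff_holds _ W).mpr (hgood r hr)
  have httW' : ∀ p : Nat.Primes, (p : ℕ) ≠ 2 → W'.HasAdditiveReductionAt ((primesEquiv (R := ℤ)).symm p) →
      ¬ (W'.quadraticTwist (((-1 : ℤ) ^ ((p : ℕ) / 2) * p : ℤ) : ℚ)).HasAdditiveReductionAt ((primesEquiv (R := ℤ)).symm p) := by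
    intro r hr2 ha'
    by_cases hrD : ((r : ℕ) : ℤ) ∣ D
    · rcases hdvd_D r hrD with h | h
      · -- `r = ℓ₀`: `W'` is multiplicative there, not additive
        exfalso
        have : r = Pℓ := Subtype.ext h
        rw [this] at ha'
        exact hmult'.not_hasAdditiveReductionAt ha'
      · exact hsemi_m r h
    · have ha : W.HasAdditiveReductionAt ((primesEquiv (R := ℤ)).symm r) := ((hred r hrD).2.2).mp ha'
      exact TwistRootNumberAnyTwo.twistType_quadraticTwist_of_not_dvd W htt D r hr2 (by rw [Rat.natGenerator_primesEquiv_symm]; exact hrD) ha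
  have hle := TwistRootNumberAnyTwo.conductorExponent_pStar_le W htt
  have hle' := TwistRootNumberAnyTwo.conductorExponent_pStar_le W' httW'
  have hdvd_iff : ∀ (n : ℕ) (hn : n ≠ 0) (p : Nat.Primes), (p : ℕ) ∣ n ↔ n.factorization p ≠ 0 := fun n hn p ↦ by
    rw [Ne, Nat.factorization_eq_zero_iff]; push Not; exact ⟨fun h ↦ ⟨p.2, h, hn⟩, fun h ↦ h.2.1⟩
  have hℓN : ℓ₀ ∣ N := (hdvd_iff N hN0 Pℓ).mpr (by rw [factorization_conductorNorm_primesEquiv_symm W Pℓ, ← hvℓ, hfℓ]; norm_num)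
  have hℓN' : ℓ₀ ∣ N' := (hdvd_iff N' hN'0 Pℓ).mpr (by rw [factorization_conductorNorm_primesEquiv_symm W' Pℓ, ← hvℓ, hfℓ']; norm_num)
  have hℓℓN' : ¬ ℓ₀ ^ 2 ∣ N' := by
    rw [hℓ₀.out.pow_dvd_iff_le_factorization hN'0, show N'.factorization ℓ₀ = N'.factorization Pℓ from rfl,
      factorization_conductorNorm_primesEquiv_symm W' Pℓ, ← hvℓ, hfℓ']; omega
  have hm_dvd_iff : ∀ r : Nat.Primes, (r : ℕ) ∣ m.natAbs ↔ ((r : ℕ) : ℤ) ∣ m := fun r ↦ Int.natCast_dvd.symm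
  have hpf : N'.primeFactors = N.primeFactors ∪ m.natAbs.primeFactors := by
    ext r
    simp only [Finset.mem_union, Nat.mem_primeFactors]
    constructor
    · rintro ⟨hr, hrN', -⟩
      set R : Nat.Primes := ⟨r, hr⟩
      by_cases hrD : ((r : ℕ) : ℤ) ∣ D
      · rcases hdvd_D R hrD with h | h
        · exact Or.inl ⟨hr, by rw [show r = ℓ₀ from h]; exact hℓN, hN0⟩
        · exact Or.inr ⟨hr, (hm_dvd_iff R).mpr h, hM0⟩
      · left
        refine ⟨hr, ?_, hN0⟩
        have h := (hdvd_iff N' hN'0 R).mp hrN'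
        rw [show N'.factorization R = N'.factorization r from rfl, hfac_eq R hrD] at h
        exact (hdvd_iff N hN0 R).mpr h
    · rintro (⟨hr, hrN, -⟩ | ⟨hr, hrM, -⟩)
      · set R : Nat.Primes := ⟨r, hr⟩
        refine ⟨hr, ?_, hN'0⟩
        by_cases hrℓ : r = ℓ₀
        · rw [hrℓ]; exact hℓN'
        · have hrD : ¬ ((r : ℕ) : ℤ) ∣ D := hbadN_not_dvd_D R hrN hrℓ
          have h := (hdvd_iff N hN0 R).mp hrN
          rw [← hfac_eq R hrD] at h
          exact (hdvd_iff N' hN'0 R).mpr h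
      · set R : Nat.Primes := ⟨r, hr⟩
        refine ⟨hr, ?_, hN'0⟩
        exact (hdvd_iff N' hN'0 R).mpr (by rw [factorization_conductorNorm_primesEquiv_symm W' R, hf_m R ((hm_dvd_iff R).mp hrM)]; norm_num)
  have hdisj : Disjoint N.primeFactors m.natAbs.primeFactors := by
    rw [Finset.disjoint_left]
    intro r hrN hrM
    obtain ⟨hr, hrN', -⟩ := Nat.mem_primeFactors.mp hrN
    obtain ⟨-, hrM', -⟩ := Nat.mem_primeFactors.mp hrM
    exact (hprime_m ⟨r, hr⟩ ((hm_dvd_iff ⟨r, hr⟩).mp hrM')).2.2 hrN'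
  have hℓmem : ℓ₀ ∈ N.primeFactors := Nat.mem_primeFactors.mpr ⟨hℓ₀.out, hℓN, hN0⟩
  obtain ⟨f, hf⟩ := hmod W
  obtain ⟨f', hf'⟩ := hmod W'
  have hε := IsNewform0.frickeEigenvalue_eq_prod_atkinLehnerEigenvalueAt_holds hf.1
  have hε' := IsNewform0.frickeEigenvalue_eq_prod_atkinLehnerEigenvalueAt_holds hf'.1
  have hlamℓ' : atkinLehnerEigenvalueAt f' ℓ₀ = 1 := by
    have h := W'.atkinLehnerEigenvalueAt_eq_localRootNumberAt_of_not_sq_dvd hf' Pℓ hℓN' hℓℓN'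
    rw [h, ← hvℓ, hlocW']
    simp
  have hlamℓ : atkinLehnerEigenvalueAt f ℓ₀ = (ZMod.χ₄ ℓ₀ : ℂ) :=
    W.atkinLehnerEigenvalueAt_eq_χ₄_of_twist_of_le hmod hf Pℓ hℓ₀2 hadd₀ hsemi₀ hfℓ (hle Pℓ hℓ₀2)
  have hlam_m : ∀ r ∈ m.natAbs.primeFactors, atkinLehnerEigenvalueAt f' r = (ZMod.χ₄ r : ℂ) := by
    intro r hr
    obtain ⟨hrp, hrM, -⟩ := Nat.mem_primeFactors.mp hr
    set R : Nat.Primes := ⟨r, hrp⟩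
    have hrm : ((R : ℕ) : ℤ) ∣ m := (hm_dvd_iff R).mp hrM
    exact W'.atkinLehnerEigenvalueAt_eq_χ₄_of_twist_of_le hmod hf' R (hprime_m R hrm).1 (hadd_m R hrm) (hsemi_m R hrm)
      (hf_m R hrm) (hle' R (hprime_m R hrm).1)
  set jf : ℕ → ℤ := fun r ↦ if N.factorization r = 1 then (if r = 2 then ZMod.χ₈ (D : ZMod 8) else jacobiSym D r) else 1 with hjf
  have hlam_eq : ∀ r ∈ N.primeFactors.erase ℓ₀, atkinLehnerEigenvalueAt f' r = (jf r : ℂ) * atkinLehnerEigenvalueAt f r := by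
    intro r hr
    obtain ⟨hrℓ, hrN⟩ := Finset.mem_erase.mp hr
    obtain ⟨hrp, hrdvd, -⟩ := Nat.mem_primeFactors.mp hrN
    set R : Nat.Primes := ⟨r, hrp⟩
    haveI := Fact.mk hrp
    have hrD : ¬ ((r : ℕ) : ℤ) ∣ D := hbadN_not_dvd_D R hrdvd hrℓ
    have hbad : ¬ W.HasGoodReductionAt ((primesEquiv (R := ℤ)).symm R) := fun hg ↦ ((W.dvd_conductorNorm_iff_not_hasGoodReductionAtPrime r).mp hrdvd)
        ((W.hasGoodReductionAtPrime_iff_hasGoodReductionAt_holds R).mpr hg)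
    rcases hasGoodReductionAt_or_hasMultiplicativeReductionAt_or_hasAdditiveReductionAt ((primesEquiv (R := ℤ)).symm R) W with h | hm | ha
    · exact absurd h hbad
    · -- multiplicative: both are local root numbers; `r` is odd (if `r = 2`, `D ≡ 1 (mod 8)` is a square and nothing flips)
      have hf1 : W.conductorExponent ((primesEquiv (R := ℤ)).symm R) = 1 := (conductorExponent_eq_one_iff_holds _ W).mpr hm
      have hf1' : W'.conductorExponent ((primesEquiv (R := ℤ)).symm R) = 1 :=
        (conductorExponent_eq_one_iff_holds _ W').mpr (((hred R hrD).2.1).mpr hm)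
      have hfac1 : N.factorization r = 1 := by
        rw [show N.factorization r = N.factorization R from rfl, factorization_conductorNorm_primesEquiv_symm W R, hf1]
      have hrN' : r ∣ N' := (hdvd_iff N' hN'0 R).mpr (by rw [factorization_conductorNorm_primesEquiv_symm W' R, hf1']; norm_num)
      have hrrN' : ¬ r ^ 2 ∣ N' := by
        rw [hrp.pow_dvd_iff_le_factorization hN'0, show N'.factorization r = N'.factorization R from rfl,
          factorization_conductorNorm_primesEquiv_symm W' R, hf1']; omega
      have hrrN : ¬ r ^ 2 ∣ N := by
        rw [hrp.pow_dvd_iff_le_factorization hN0, show N.factorization r = N.factorization R from rfl,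
          factorization_conductorNorm_primesEquiv_symm W R, hf1]; omega
      rw [W'.atkinLehnerEigenvalueAt_eq_localRootNumberAt_of_not_sq_dvd hf' R hrN' hrrN',
        W.atkinLehnerEigenvalueAt_eq_localRootNumberAt_of_not_sq_dvd hf R hrdvd hrrN]
      simp only [hjf, hfac1, if_true]
      by_cases hr2 : r = 2
      · -- `r = 2` (multiplicative): `w₂(E^{(D)}) = χ₈(D)·w₂(E)` (the split type flips iff `D ≡ 5 (8)`, p812548)
        have hRP : R = P2 := Subtype.ext hr2
        simp only [hr2, if_true]
        rw [hRP] at hm ⊢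
        rw [hW', localRootNumberAt_two_quadraticTwist_eq_χ₈_mul W hD4 hm]
        push_cast; ring
      · simp only [hr2, if_false]
        rcases jacobiSym.eq_one_or_neg_one (a := D) (b := r) (by
            rw [Int.gcd_eq_natAbs, Int.natAbs_natCast]
            exact Nat.Coprime.symm ((Nat.Prime.coprime_iff_not_dvd hrp).mpr fun h ↦ hrD (Int.natCast_dvd.mpr h))) with hj | hj
        · -- square: the curves are isomorphic over `ℚ_r`
          rw [W.localRootNumberAt_quadraticTwist_of_isSquare R hD0 (isSquare_padic_of_jacobiSym_eq_one hr2 hj), hj]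
          push_cast; ring
        · -- non-square unit at a multiplicative prime: split and non-split are swapped, the local root number flips
          obtain ⟨w, hw⟩ : ∃ w : HeightOneSpectrum (𝓞 ℚ), (primesEquiv w : ℕ) = r := ⟨(primesEquiv (R := 𝓞 ℚ)).symm R, by simp [R]⟩
          have hmQ : W.HasMultiplicativeReductionAtPrime r := (W.hasMultiplicativeReductionAtPrime_iff_hasMultiplicativeReductionAt_holds R).mpr hm
          have hmQ' : W'.HasMultiplicativeReductionAtPrime r :=
            (W'.hasMultiplicativeReductionAtPrime_iff_hasMultiplicativeReductionAt_holds R).mpr (((hred R hrD).2.1).mpr hm)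
          have hm_w : W.HasMultiplicativeReductionAt w := (hasMultiplicativeReductionAtPrime_primesEquiv_iff_holds W w r hw).mp hmQ
          have hw2 : (primesEquiv w : ℕ) ≠ 2 := by rw [hw]; exact hr2
          have hwD : ¬ ((primesEquiv w : ℕ) : ℤ) ∣ D := by rw [hw]; exact hrD
          obtain ⟨-, -, key⟩ := AdditivePotMult.hasMultiplicativeReductionAt_and_split_iff_quadraticTwist_of_not_dvd W w hw2 hwD hm_w
          have hnsq : ¬ IsSquare ((D : ℤ) : ZMod (primesEquiv w : ℕ)) := by
            rw [hw]; exact ZMod.nonsquare_of_jacobiSym_eq_neg_one hj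
          have e1 : W'.HasSplitMultiplicativeReductionAt w ↔ W'.HasSplitMultiplicativeReductionAtPrime r := by
            rw [← W'.hasSplitMultiplicativeReductionAtPrime_iff_hasSplitMultiplicativeReductionAt w]; subst hw; rfl
          have e2 : W.HasSplitMultiplicativeReductionAt w ↔ W.HasSplitMultiplicativeReductionAtPrime r := by
            rw [← W.hasSplitMultiplicativeReductionAtPrime_iff_hasSplitMultiplicativeReductionAt w]; subst hw; rfl
          rw [hW'] at e1
          rw [e1, e2] at key
          have hflip : (W.quadraticTwist (D : ℚ)).HasSplitMultiplicativeReductionAtPrime r ↔ ¬ W.HasSplitMultiplicativeReductionAtPrime r := by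
            rw [key]; constructor
            · intro h hs; exact hnsq (h.mpr hs)
            · intro h; exact ⟨fun hsq ↦ absurd hsq hnsq, fun hs ↦ absurd hs h⟩
          rw [localRootNumberAt_primesEquiv_symm_eq, localRootNumberAt_primesEquiv_symm_eq, hj]
          by_cases hs : W.HasSplitMultiplicativeReductionAtPrime r
          · have hns' : ¬ W'.HasSplitMultiplicativeReductionAtPrime r := by rw [hW']; exact fun h ↦ (hflip.mp h) hs
            rw [localRootNumber_of_hasMultiplicativeReduction _ _ hmQ' hns', localRootNumber_of_hasSplitMultiplicativeReduction _ _ hs]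
            push_cast; ring
          · have hs' : W'.HasSplitMultiplicativeReductionAtPrime r := by rw [hW']; exact hflip.mpr hs
            rw [localRootNumber_of_hasSplitMultiplicativeReduction _ _ hs', localRootNumber_of_hasMultiplicativeReduction _ _ hmQ hs]
            push_cast; ring
    · -- additive: the level keeps `r` to an exponent `≥ 2`, so the engine's factor is `1`
      have hfac2 : N.factorization r ≠ 1 := by
        rw [show N.factorization r = N.factorization R from rfl, factorization_conductorNorm_primesEquiv_symm W R]
        have := (two_le_conductorExponent_iff_holds ((primesEquiv (R := ℤ)).symm R) W).mpr ha; omega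
      by_cases hr2 : r = 2
      · -- `r = 2`, twist type with parameter `t`: `λ₂(f') = λ₂(f) = χ_t(−1)` (LEAD g18, Atkin–Li via p814752)
        have hRP : R = P2 := Subtype.ext hr2
        rw [hRP] at ha
        obtain ⟨t, ht, hnt⟩ := h2tt P2 rfl ha
        have hkey := atkinLehnerEigenvalueAt_two_quadraticTwist_eq_of_twistType_two W hmod ht ha hnt hD4 hf rfl hf' (by rw [hW'])
        simp only [hjf, if_neg hfac2]
        rw [hr2, hkey]
        push_cast; ring
      have hsemi := htt R hr2 ha
      have ha' : W'.HasAdditiveReductionAt ((primesEquiv (R := ℤ)).symm R) := ((hred R hrD).2.2).mpr ha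
      have hsemi' := httW' R hr2 ha'
      rw [W'.atkinLehnerEigenvalueAt_eq_χ₄_of_twist_of_le hmod hf' R hr2 ha' hsemi'
          (TwistTypeConductor.conductorExponent_eq_two_of_twistType_odd W' R hr2 ha' (fun _ ↦ hsemi')) (hle' R hr2),
        W.atkinLehnerEigenvalueAt_eq_χ₄_of_twist_of_le hmod hf R hr2 ha hsemi
          (TwistTypeConductor.conductorExponent_eq_two_of_twistType_odd W R hr2 ha (fun _ ↦ hsemi)) (hle R hr2)]
      simp only [hjf, if_neg hfac2]
      push_cast; ring
  have hP : ∏ r ∈ N.primeFactors.erase ℓ₀, atkinLehnerEigenvalueAt f' r =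
      (∏ r ∈ N.primeFactors.erase ℓ₀, (jf r : ℂ)) * ∏ r ∈ N.primeFactors.erase ℓ₀, atkinLehnerEigenvalueAt f r := by
    rw [Finset.prod_congr rfl hlam_eq, Finset.prod_mul_distrib]
  have hPm' : ∏ r ∈ m.natAbs.primeFactors, ZMod.χ₄ (r : ZMod 4) = ZMod.χ₄ (m.natAbs : ZMod 4) := by
    conv_rhs => rw [← Nat.prod_primeFactors_of_squarefree hMsq, Nat.cast_prod, map_prod]
  have hPm : ∏ r ∈ m.natAbs.primeFactors, atkinLehnerEigenvalueAt f' r = (ZMod.χ₄ (m.natAbs : ZMod 4) : ℂ) := by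
    rw [Finset.prod_congr rfl hlam_m]
    exact_mod_cast congrArg (fun z : ℤ ↦ (z : ℂ)) hPm'
  have hχ : (ZMod.χ₄ (m.natAbs : ZMod 4) : ℂ) = (ZMod.χ₄ (D.natAbs : ZMod 4) : ℂ) * (ZMod.χ₄ ℓ₀ : ℂ) := by
    have hMD : D.natAbs = ℓ₀ * m.natAbs := by
      rw [hDm, hs, Int.natAbs_mul, Int.natAbs_mul, Int.natAbs_pow, Int.natAbs_neg, Int.natAbs_one, one_pow, one_mul, Int.natAbs_natCast]
    have hprod : ZMod.χ₄ (D.natAbs : ZMod 4) = ZMod.χ₄ (ℓ₀ : ZMod 4) * ZMod.χ₄ (m.natAbs : ZMod 4) := by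
      rw [← map_mul, ← Nat.cast_mul, ← hMD]
    have hℓsq : ZMod.χ₄ (ℓ₀ : ZMod 4) * ZMod.χ₄ (ℓ₀ : ZMod 4) = 1 := by
      rcases Nat.odd_mod_four_iff.mp (Nat.odd_iff.mp (hℓ₀.out.odd_of_ne_two hℓ₀2)) with h | h
      · rw [ZMod.χ₄_nat_one_mod_four h]; norm_num
      · rw [ZMod.χ₄_nat_three_mod_four h]; norm_num
    have key : ZMod.χ₄ (m.natAbs : ZMod 4) = ZMod.χ₄ (D.natAbs : ZMod 4) * ZMod.χ₄ (ℓ₀ : ZMod 4) := by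
      rw [hprod]; linear_combination (-(ZMod.χ₄ (m.natAbs : ZMod 4))) * hℓsq
    exact_mod_cast congrArg (fun z : ℤ ↦ (z : ℂ)) key
  have hεeq : frickeEigenvalue f' = (ZMod.χ₄ (D.natAbs : ZMod 4) : ℂ) * (∏ r ∈ N.primeFactors.erase ℓ₀, (jf r : ℂ)) * frickeEigenvalue f := by
    rw [hε', hε, hpf, Finset.prod_union hdisj, ← Finset.mul_prod_erase _ _ hℓmem,
      ← Finset.mul_prod_erase N.primeFactors _ hℓmem, hlamℓ', hlamℓ, hP, hPm, hχ]
    ring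
  have hw' := rootNumber_eq_neg_frickeEigenvalue (W := W') (fun _ _ ↦ IsNewform0.exists_functional_equation_holds)
    (fun _ _ ↦ IsNewform0.frickeEigenvalue_eq_one_or_eq_neg_one_holds) hf'
  have hw := rootNumber_eq_neg_frickeEigenvalue (W := W) (fun _ _ ↦ IsNewform0.exists_functional_equation_holds)
    (fun _ _ ↦ IsNewform0.frickeEigenvalue_eq_one_or_eq_neg_one_holds) hf
  have hwf : frickeEigenvalue f = -((W.rootNumber : ℤ) : ℂ) := by rw [hw]; ring
  have h : ((W'.rootNumber : ℤ) : ℂ) =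
      ((ZMod.χ₄ (D.natAbs : ZMod 4) : ℤ) : ℂ) * ((∏ r ∈ N.primeFactors.erase ℓ₀, jf r : ℤ) : ℂ) * ((W.rootNumber : ℤ) : ℂ) := by
    rw [hw', hεeq, hwf]; push_cast; ring
  exact_mod_cast h

end Summit.BirchSwinnertonDyer.BirchSwinnertonDyer.Theorems.TwistRootNumberTwisted

end
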